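import Mathlib

/-!
# Discrete Fourier inversion for a symmetric low-pass kernel on `(ℤ/S)³` (route-independent support for
# `SqueezedSkewness.HighBallFloorsLPGlue`, stmt-QuantumFields-22797)

For `S ≥ 1`, a predicate `lp` on `(Fin S)³` that is symmetric under `q ↦ −q (mod S)`, and the kernel
`κ(z) = S⁻³ Σ_{q : lp q} cos(2π (q·z)/S)` (the route file's `let κ`, dot product computed on the `.val`s), the characters of
`(ℤ/S)³` give, for every integer frequency `m`,
`Σ_{z ∈ (Fin S)³} κ(z) e^{2πi (m·z)/S} = 1[lp (m mod S)]`.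
Pure finite Fourier analysis (`Σ_{z : Fin S} e^{2πi n z/S} = S·1[S ∣ n]` from the primitive root `e^{2πi/S}`); no definitions.
[folklore]
-/

noncomputable section

open scoped BigOperators
open Finset Complex

namespace Summit.QuantumFields.YangMills.Theorems.SqueezedSkewnessLowPassDFT

/-! ## §1 One-dimensional character sums -/

/-- `Σ_{z < S} e^{2πi n z / S} = S` if `S ∣ n`, else `0` (`S ≥ 1`, `n ∈ ℤ`). [folklore] -/
theorem sum_cexp_int_mul (S : ℕ) (hS : 0 < S) (n : ℤ) :
    ∑ z : Fin S, cexp (2 * Real.pi * I * ((n : ℂ) * ((z : ℕ) : ℂ)) / (S : ℂ)) =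
      if (S : ℤ) ∣ n then (S : ℂ) else 0 := by
  have hS0 : (S : ℂ) ≠ 0 := by exact_mod_cast hS.ne'
  have hprim : IsPrimitiveRoot (cexp (2 * Real.pi * I / (S : ℂ))) S := Complex.isPrimitiveRoot_exp S hS.ne'
  set ζ₀ : ℂ := cexp (2 * Real.pi * I / (S : ℂ)) with hζ₀
  set ζ : ℂ := ζ₀ ^ n with hζ
  have hterm : ∀ z : Fin S, cexp (2 * Real.pi * I * ((n : ℂ) * ((z : ℕ) : ℂ)) / (S : ℂ)) = ζ ^ (z : ℕ) := by
    intro z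
    have h1 : 2 * Real.pi * I * ((n : ℂ) * ((z : ℕ) : ℂ)) / (S : ℂ) = ((n * (z : ℕ) : ℤ) : ℂ) * (2 * Real.pi * I / (S : ℂ)) := by
      push_cast; field_simp
    rw [h1, Complex.exp_int_mul, ← hζ₀, zpow_mul, zpow_natCast]
  simp_rw [hterm]
  rw [Fin.sum_univ_eq_sum_range (fun i => ζ ^ i) S]
  have hζS : ζ ^ S = 1 := by
    rw [hζ, ← zpow_natCast, ← zpow_mul, mul_comm, zpow_mul, zpow_natCast, hprim.pow_eq_one, one_zpow]
  by_cases hdvd : (S : ℤ) ∣ n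
  · rw [if_pos hdvd]
    have hζ1 : ζ = 1 := (hprim.zpow_eq_one_iff_dvd n).mpr hdvd
    simp [hζ1]
  · rw [if_neg hdvd]
    have hζ1 : ζ ≠ 1 := fun h => hdvd ((hprim.zpow_eq_one_iff_dvd n).mp h)
    rw [geom_sum_eq hζ1, hζS, sub_self, zero_div]

/-- The integers `q < S` with `S ∣ q − m` are exactly `q = m mod S`: a filtered sum over `Fin S` collapses. [folklore] -/
theorem sum_ite_dvd_sub_eq (S : ℕ) (hS : 0 < S) (m : ℤ) (g : Fin S → ℂ) :
    ∑ q : Fin S, (if (S : ℤ) ∣ ((q : ℕ) : ℤ) - m then g q else 0) =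
      g ⟨(m % (S : ℤ)).toNat, by
        have h0 : 0 ≤ m % (S : ℤ) := Int.emod_nonneg _ (by exact_mod_cast hS.ne')
        have h1 : m % (S : ℤ) < (S : ℤ) := Int.emod_lt_of_pos _ (by exact_mod_cast hS)
        omega⟩ := by
  have h0 : 0 ≤ m % (S : ℤ) := Int.emod_nonneg _ (by exact_mod_cast hS.ne')
  have h1 : m % (S : ℤ) < (S : ℤ) := Int.emod_lt_of_pos _ (by exact_mod_cast hS)
  rw [← Finset.sum_filter]
  have hfilter : (Finset.univ.filter fun q : Fin S => (S : ℤ) ∣ ((q : ℕ) : ℤ) - m) =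
      {⟨(m % (S : ℤ)).toNat, by omega⟩} := by
    ext q
    simp only [Finset.mem_filter, Finset.mem_univ, true_and, Finset.mem_singleton]
    have hqlt : ((q : ℕ) : ℤ) % (S : ℤ) = ((q : ℕ) : ℤ) :=
      Int.emod_eq_of_lt (by positivity) (by exact_mod_cast q.isLt)
    constructor
    · intro hq
      apply Fin.ext
      have h2 : (((q : ℕ) : ℤ) - m) % (S : ℤ) = 0 := Int.emod_eq_zero_of_dvd hq
      have h3 : ((q : ℕ) : ℤ) % (S : ℤ) = m % (S : ℤ) := (Int.emod_eq_emod_iff_emod_sub_eq_zero).mpr h2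
      rw [hqlt] at h3
      show (q : ℕ) = (m % (S : ℤ)).toNat
      omega
    · intro hq
      subst hq
      have hval : (((m % (S : ℤ)).toNat : ℕ) : ℤ) = m % (S : ℤ) := Int.toNat_of_nonneg h0
      have hmod : m ≡ (((m % (S : ℤ)).toNat : ℕ) : ℤ) [ZMOD (S : ℤ)] := by
        unfold Int.ModEq
        rw [hval, Int.emod_emod_of_dvd _ (dvd_refl _)]
      exact hmod.dvd
  rw [hfilter, Finset.sum_singleton]

/-- Multiplicative form of the collapse: `Σ_q 1[S ∣ q − m]·g q = g (m mod S)`. [folklore] -/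
theorem sum_indicator_dvd_sub_mul (S : ℕ) (hS : 0 < S) (m : ℤ) (g : Fin S → ℂ) :
    ∑ q : Fin S, (if (S : ℤ) ∣ ((q : ℕ) : ℤ) - m then (1 : ℂ) else 0) * g q =
      g ⟨(m % (S : ℤ)).toNat, by
        have h0 : 0 ≤ m % (S : ℤ) := Int.emod_nonneg _ (by exact_mod_cast hS.ne')
        have h1 : m % (S : ℤ) < (S : ℤ) := Int.emod_lt_of_pos _ (by exact_mod_cast hS)
        omega⟩ := by
  rw [← sum_ite_dvd_sub_eq S hS m g]
  refine Finset.sum_congr rfl fun q _ => ?_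
  split_ifs <;> simp

/-- A triple sum of a product of one-variable factors is the product of the three sums. [folklore] -/
theorem sum_prod3 (S : ℕ) (F G H : Fin S → ℂ) :
    ∑ z : Fin S × Fin S × Fin S, F z.1 * G z.2.1 * H z.2.2 = (∑ a, F a) * (∑ b, G b) * (∑ c, H c) := by
  rw [Fintype.sum_prod_type]
  have h1 : ∀ a : Fin S, ∑ p : Fin S × Fin S, F (a, p).1 * G (a, p).2.1 * H (a, p).2.2 =
      F a * ((∑ b, G b) * (∑ c, H c)) := by
    intro a
    rw [Fintype.sum_prod_type, Finset.sum_mul_sum, Finset.mul_sum]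
    refine Finset.sum_congr rfl fun b _ => ?_
    rw [Finset.mul_sum]
    refine Finset.sum_congr rfl fun c _ => ?_
    ring
  simp_rw [h1]
  rw [← Finset.sum_mul]
  ring

/-- The 3-D character sum: `Σ_{z ∈ (Fin S)³} e^{2πi (c·z)/S} = ∏_i S·1[S ∣ c_i]`. [folklore] -/
theorem sum_cexp_dot (S : ℕ) (hS : 0 < S) (c₀ c₁ c₂ : ℤ) :
    ∑ z : Fin S × Fin S × Fin S,
        cexp (2 * Real.pi * I * ((c₀ : ℂ) * ((z.1 : ℕ) : ℂ) + (c₁ : ℂ) * ((z.2.1 : ℕ) : ℂ) +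
          (c₂ : ℂ) * ((z.2.2 : ℕ) : ℂ)) / (S : ℂ)) =
      (if (S : ℤ) ∣ c₀ then (S : ℂ) else 0) * (if (S : ℤ) ∣ c₁ then (S : ℂ) else 0) *
        (if (S : ℤ) ∣ c₂ then (S : ℂ) else 0) := by
  have hsplit : ∀ z : Fin S × Fin S × Fin S,
      cexp (2 * Real.pi * I * ((c₀ : ℂ) * ((z.1 : ℕ) : ℂ) + (c₁ : ℂ) * ((z.2.1 : ℕ) : ℂ) +
          (c₂ : ℂ) * ((z.2.2 : ℕ) : ℂ)) / (S : ℂ)) =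
        cexp (2 * Real.pi * I * ((c₀ : ℂ) * ((z.1 : ℕ) : ℂ)) / (S : ℂ)) *
          cexp (2 * Real.pi * I * ((c₁ : ℂ) * ((z.2.1 : ℕ) : ℂ)) / (S : ℂ)) *
          cexp (2 * Real.pi * I * ((c₂ : ℂ) * ((z.2.2 : ℕ) : ℂ)) / (S : ℂ)) := by
    intro z
    rw [← Complex.exp_add, ← Complex.exp_add]
    congr 1
    ring
  simp_rw [hsplit]
  rw [sum_prod3 S (fun a => cexp (2 * Real.pi * I * ((c₀ : ℂ) * ((a : ℕ) : ℂ)) / (S : ℂ)))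
    (fun b => cexp (2 * Real.pi * I * ((c₁ : ℂ) * ((b : ℕ) : ℂ)) / (S : ℂ)))
    (fun c => cexp (2 * Real.pi * I * ((c₂ : ℂ) * ((c : ℕ) : ℂ)) / (S : ℂ))),
    sum_cexp_int_mul S hS, sum_cexp_int_mul S hS, sum_cexp_int_mul S hS]

/-- `cos θ = (e^{iθ} + e^{−iθ})/2` in `ℂ` for real `θ`. [folklore] -/
theorem ofReal_cos_eq (θ : ℝ) : ((Real.cos θ : ℝ) : ℂ) = (cexp ((θ : ℂ) * I) + cexp (-((θ : ℂ) * I))) / 2 := by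
  rw [Complex.ofReal_cos, Complex.cos]
  ring_nf

/-- The reduced representative `(m mod S)` as an element of `Fin S`. -/
theorem toNat_emod_lt (S : ℕ) (hS : 0 < S) (m : ℤ) : (m % (S : ℤ)).toNat < S := by
  have h0 : 0 ≤ m % (S : ℤ) := Int.emod_nonneg _ (by exact_mod_cast hS.ne')
  have h1 : m % (S : ℤ) < (S : ℤ) := Int.emod_lt_of_pos _ (by exact_mod_cast hS)
  omega

/-- `cos θ · e^{φ} = ½ (e^{iθ + φ} + e^{−iθ + φ})`. [folklore] -/
theorem ofReal_cos_mul_cexp (θ : ℝ) (φ : ℂ) :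
    ((Real.cos θ : ℝ) : ℂ) * cexp φ = (1 / 2 : ℂ) * (cexp ((θ : ℂ) * I + φ) + cexp (-((θ : ℂ) * I) + φ)) := by
  rw [ofReal_cos_eq, Complex.exp_add, Complex.exp_add]
  ring

/-- `1[n ∣ a − b] = 1[n ∣ b − a]` inside an `if`. -/
theorem ite_dvd_sub_comm (n a b : ℤ) (c : ℂ) : (if n ∣ a - b then c else (0 : ℂ)) = (if n ∣ b - a then c else 0) :=
  if_congr dvd_sub_comm rfl rfl

/-- `S·1[p] = S * 1[p]`. -/
theorem ite_S_eq (S : ℕ) (p : Prop) [Decidable p] : (if p then (S : ℂ) else 0) = (S : ℂ) * (if p then 1 else 0) := by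
  split_ifs <;> simp

/-- Triple collapse: `Σ_{(a,b,c)} 1[S∣a−m₀]1[S∣b−m₁]1[S∣c−m₂]·g(a,b,c) = g(m mod S)`. [folklore] -/
theorem sum_indicator3 (S : ℕ) (hS : 0 < S) (m₀ m₁ m₂ : ℤ) (g : Fin S × Fin S × Fin S → ℂ) :
    ∑ q : Fin S × Fin S × Fin S,
      (if (S : ℤ) ∣ ((q.1 : ℕ) : ℤ) - m₀ then (1 : ℂ) else 0) * (if (S : ℤ) ∣ ((q.2.1 : ℕ) : ℤ) - m₁ then (1 : ℂ) else 0) *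
        (if (S : ℤ) ∣ ((q.2.2 : ℕ) : ℤ) - m₂ then (1 : ℂ) else 0) * g q =
      g (⟨(m₀ % (S : ℤ)).toNat, toNat_emod_lt S hS m₀⟩, ⟨(m₁ % (S : ℤ)).toNat, toNat_emod_lt S hS m₁⟩,
          ⟨(m₂ % (S : ℤ)).toNat, toNat_emod_lt S hS m₂⟩) := by
  rw [Fintype.sum_prod_type]
  have h1 : ∀ a : Fin S, ∑ p : Fin S × Fin S,
      (if (S : ℤ) ∣ (((a, p).1 : ℕ) : ℤ) - m₀ then (1 : ℂ) else 0) * (if (S : ℤ) ∣ (((a, p).2.1 : ℕ) : ℤ) - m₁ then (1 : ℂ) else 0) *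
        (if (S : ℤ) ∣ (((a, p).2.2 : ℕ) : ℤ) - m₂ then (1 : ℂ) else 0) * g (a, p) =
      (if (S : ℤ) ∣ ((a : ℕ) : ℤ) - m₀ then (1 : ℂ) else 0) *
        ∑ b : Fin S, (if (S : ℤ) ∣ ((b : ℕ) : ℤ) - m₁ then (1 : ℂ) else 0) *
          ∑ c : Fin S, (if (S : ℤ) ∣ ((c : ℕ) : ℤ) - m₂ then (1 : ℂ) else 0) * g (a, b, c) := by
    intro a
    rw [Fintype.sum_prod_type, Finset.mul_sum]
    refine Finset.sum_congr rfl fun b _ => ?_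
    rw [Finset.mul_sum, Finset.mul_sum]
    refine Finset.sum_congr rfl fun c _ => ?_
    simp only
    ring
  simp_rw [h1]
  rw [sum_indicator_dvd_sub_mul S hS m₀, sum_indicator_dvd_sub_mul S hS m₁, sum_indicator_dvd_sub_mul S hS m₂]

/-- The two reduced representatives `(−m) mod S` and `m mod S` sum to a multiple of `S`. -/
theorem dvd_toNat_emod_neg_add (S : ℕ) (hS : 0 < S) (m : ℤ) :
    S ∣ ((-m) % (S : ℤ)).toNat + (m % (S : ℤ)).toNat := by
  have hS' : (S : ℤ) ≠ 0 := by exact_mod_cast hS.ne'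
  have h0 : 0 ≤ (-m) % (S : ℤ) := Int.emod_nonneg _ hS'
  have h0' : 0 ≤ m % (S : ℤ) := Int.emod_nonneg _ hS'
  have hint : (S : ℤ) ∣ (((-m) % (S : ℤ)).toNat : ℤ) + ((m % (S : ℤ)).toNat : ℤ) := by
    rw [Int.toNat_of_nonneg h0, Int.toNat_of_nonneg h0']
    have h1 : ((-m) % (S : ℤ) + m % (S : ℤ)) % (S : ℤ) = (-m + m) % (S : ℤ) := (Int.add_emod _ _ _).symm
    rw [neg_add_cancel, Int.zero_emod] at h1
    exact Int.dvd_of_emod_eq_zero h1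
  exact_mod_cast hint

/-- **DISCRETE FOURIER INVERSION FOR A SYMMETRIC KERNEL ON `(ℤ/S)³`.**  For `χ : (Fin S)³ → ℝ` symmetric under
`q ↦ −q (mod S)` and `κ(z) = S⁻³ Σ_q χ(q) cos(2π (q·z)/S)` (dot product on the `.val`s, as in the route's `let κ`):
`Σ_z κ(z) e^{2πi (m·z)/S} = χ(m mod S)` for every `m ∈ ℤ³`. [folklore] -/
theorem lowPass_dft (S : ℕ) (hS : 0 < S) (χ : Fin S × Fin S × Fin S → ℝ)
    (hsymm : ∀ q q' : Fin S × Fin S × Fin S, S ∣ q.1.val + q'.1.val → S ∣ q.2.1.val + q'.2.1.val →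
      S ∣ q.2.2.val + q'.2.2.val → χ q = χ q')
    (m₀ m₁ m₂ : ℤ) :
    ∑ z : Fin S × Fin S × Fin S,
      (((1 / (S : ℝ) ^ 3) * ∑ q : Fin S × Fin S × Fin S,
          χ q * Real.cos (2 * Real.pi * ((q.1.val * z.1.val + q.2.1.val * z.2.1.val + q.2.2.val * z.2.2.val : ℕ) : ℝ) / S) : ℝ) : ℂ)
        * cexp (2 * Real.pi * I * ((m₀ : ℂ) * ((z.1 : ℕ) : ℂ) + (m₁ : ℂ) * ((z.2.1 : ℕ) : ℂ) +
            (m₂ : ℂ) * ((z.2.2 : ℕ) : ℂ)) / (S : ℂ))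
      = (χ (⟨(m₀ % (S : ℤ)).toNat, toNat_emod_lt S hS m₀⟩, ⟨(m₁ % (S : ℤ)).toNat, toNat_emod_lt S hS m₁⟩,
          ⟨(m₂ % (S : ℤ)).toNat, toNat_emod_lt S hS m₂⟩) : ℂ) := by
  have hS0 : (S : ℂ) ≠ 0 := by exact_mod_cast hS.ne'
  -- the per-term identity `κ(z) e^{iφ} = S⁻³ Σ_q χ q · ½ (e^{2πi(q+m)·z/S} + e^{2πi(m−q)·z/S})`
  have key : ∀ (q z : Fin S × Fin S × Fin S),
      ((χ q * Real.cos (2 * Real.pi * ((q.1.val * z.1.val + q.2.1.val * z.2.1.val + q.2.2.val * z.2.2.val : ℕ) : ℝ) / S) : ℝ) : ℂ)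
        * cexp (2 * Real.pi * I * ((m₀ : ℂ) * ((z.1 : ℕ) : ℂ) + (m₁ : ℂ) * ((z.2.1 : ℕ) : ℂ) +
            (m₂ : ℂ) * ((z.2.2 : ℕ) : ℂ)) / (S : ℂ)) =
      (χ q : ℂ) * ((1 / 2 : ℂ) *
        (cexp (2 * Real.pi * I * (((((q.1 : ℕ) : ℤ) + m₀ : ℤ) : ℂ) * ((z.1 : ℕ) : ℂ) +
            ((((q.2.1 : ℕ) : ℤ) + m₁ : ℤ) : ℂ) * ((z.2.1 : ℕ) : ℂ) + ((((q.2.2 : ℕ) : ℤ) + m₂ : ℤ) : ℂ) * ((z.2.2 : ℕ) : ℂ)) / (S : ℂ)) +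
         cexp (2 * Real.pi * I * (((m₀ - ((q.1 : ℕ) : ℤ) : ℤ) : ℂ) * ((z.1 : ℕ) : ℂ) +
            ((m₁ - ((q.2.1 : ℕ) : ℤ) : ℤ) : ℂ) * ((z.2.1 : ℕ) : ℂ) + ((m₂ - ((q.2.2 : ℕ) : ℤ) : ℤ) : ℂ) * ((z.2.2 : ℕ) : ℂ)) / (S : ℂ)))) := by
    intro q z
    rw [Complex.ofReal_mul, mul_assoc, ofReal_cos_mul_cexp]
    congr 2
    · congr 1
      · congr 1; push_cast; field_simp; ring
      · congr 1; push_cast; field_simp; ring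
  -- assemble
  calc ∑ z : Fin S × Fin S × Fin S,
      (((1 / (S : ℝ) ^ 3) * ∑ q : Fin S × Fin S × Fin S,
          χ q * Real.cos (2 * Real.pi * ((q.1.val * z.1.val + q.2.1.val * z.2.1.val + q.2.2.val * z.2.2.val : ℕ) : ℝ) / S) : ℝ) : ℂ)
        * cexp (2 * Real.pi * I * ((m₀ : ℂ) * ((z.1 : ℕ) : ℂ) + (m₁ : ℂ) * ((z.2.1 : ℕ) : ℂ) +
            (m₂ : ℂ) * ((z.2.2 : ℕ) : ℂ)) / (S : ℂ))
      = ∑ z : Fin S × Fin S × Fin S, ∑ q : Fin S × Fin S × Fin S, (1 / (S : ℂ) ^ 3) * ((χ q : ℂ) * ((1 / 2 : ℂ) *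
        (cexp (2 * Real.pi * I * (((((q.1 : ℕ) : ℤ) + m₀ : ℤ) : ℂ) * ((z.1 : ℕ) : ℂ) +
            ((((q.2.1 : ℕ) : ℤ) + m₁ : ℤ) : ℂ) * ((z.2.1 : ℕ) : ℂ) + ((((q.2.2 : ℕ) : ℤ) + m₂ : ℤ) : ℂ) * ((z.2.2 : ℕ) : ℂ)) / (S : ℂ)) +
         cexp (2 * Real.pi * I * (((m₀ - ((q.1 : ℕ) : ℤ) : ℤ) : ℂ) * ((z.1 : ℕ) : ℂ) +
            ((m₁ - ((q.2.1 : ℕ) : ℤ) : ℤ) : ℂ) * ((z.2.1 : ℕ) : ℂ) + ((m₂ - ((q.2.2 : ℕ) : ℤ) : ℤ) : ℂ) * ((z.2.2 : ℕ) : ℂ)) / (S : ℂ))))) := by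
        refine Finset.sum_congr rfl fun z _ => ?_
        rw [Complex.ofReal_mul, Complex.ofReal_sum, Finset.mul_sum, Finset.sum_mul]
        refine Finset.sum_congr rfl fun q _ => ?_
        rw [mul_assoc, key q z]
        push_cast
        ring
    _ = ∑ q : Fin S × Fin S × Fin S, (1 / (S : ℂ) ^ 3) * ((χ q : ℂ) * ((1 / 2 : ℂ) *
        ((∑ z : Fin S × Fin S × Fin S, cexp (2 * Real.pi * I * (((((q.1 : ℕ) : ℤ) + m₀ : ℤ) : ℂ) * ((z.1 : ℕ) : ℂ) +
            ((((q.2.1 : ℕ) : ℤ) + m₁ : ℤ) : ℂ) * ((z.2.1 : ℕ) : ℂ) + ((((q.2.2 : ℕ) : ℤ) + m₂ : ℤ) : ℂ) * ((z.2.2 : ℕ) : ℂ)) / (S : ℂ))) +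
         ∑ z : Fin S × Fin S × Fin S, cexp (2 * Real.pi * I * (((m₀ - ((q.1 : ℕ) : ℤ) : ℤ) : ℂ) * ((z.1 : ℕ) : ℂ) +
            ((m₁ - ((q.2.1 : ℕ) : ℤ) : ℤ) : ℂ) * ((z.2.1 : ℕ) : ℂ) + ((m₂ - ((q.2.2 : ℕ) : ℤ) : ℤ) : ℂ) * ((z.2.2 : ℕ) : ℂ)) / (S : ℂ))))) := by
        rw [Finset.sum_comm]
        refine Finset.sum_congr rfl fun q _ => ?_
        rw [← Finset.mul_sum, ← Finset.mul_sum, ← Finset.mul_sum, Finset.sum_add_distrib]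
    _ = ∑ q : Fin S × Fin S × Fin S, (1 / (S : ℂ) ^ 3) * ((χ q : ℂ) * ((1 / 2 : ℂ) *
        (((if (S : ℤ) ∣ ((q.1 : ℕ) : ℤ) + m₀ then (S : ℂ) else 0) * (if (S : ℤ) ∣ ((q.2.1 : ℕ) : ℤ) + m₁ then (S : ℂ) else 0) *
            (if (S : ℤ) ∣ ((q.2.2 : ℕ) : ℤ) + m₂ then (S : ℂ) else 0)) +
          ((if (S : ℤ) ∣ m₀ - ((q.1 : ℕ) : ℤ) then (S : ℂ) else 0) * (if (S : ℤ) ∣ m₁ - ((q.2.1 : ℕ) : ℤ) then (S : ℂ) else 0) *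
            (if (S : ℤ) ∣ m₂ - ((q.2.2 : ℕ) : ℤ) then (S : ℂ) else 0))))) := by
        refine Finset.sum_congr rfl fun q _ => ?_
        rw [sum_cexp_dot S hS, sum_cexp_dot S hS]
    _ = (1 / 2 : ℂ) * ((∑ q : Fin S × Fin S × Fin S,
          (if (S : ℤ) ∣ ((q.1 : ℕ) : ℤ) - (-m₀) then (1 : ℂ) else 0) * (if (S : ℤ) ∣ ((q.2.1 : ℕ) : ℤ) - (-m₁) then (1 : ℂ) else 0) *
            (if (S : ℤ) ∣ ((q.2.2 : ℕ) : ℤ) - (-m₂) then (1 : ℂ) else 0) * (χ q : ℂ)) +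
        (∑ q : Fin S × Fin S × Fin S,
          (if (S : ℤ) ∣ ((q.1 : ℕ) : ℤ) - m₀ then (1 : ℂ) else 0) * (if (S : ℤ) ∣ ((q.2.1 : ℕ) : ℤ) - m₁ then (1 : ℂ) else 0) *
            (if (S : ℤ) ∣ ((q.2.2 : ℕ) : ℤ) - m₂ then (1 : ℂ) else 0) * (χ q : ℂ))) := by
        rw [mul_add, Finset.mul_sum, Finset.mul_sum, ← Finset.sum_add_distrib]
        refine Finset.sum_congr rfl fun q _ => ?_
        simp only [sub_neg_eq_add]
        rw [ite_dvd_sub_comm (S : ℤ) m₀, ite_dvd_sub_comm (S : ℤ) m₁, ite_dvd_sub_comm (S : ℤ) m₂]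
        rw [ite_S_eq S, ite_S_eq S, ite_S_eq S, ite_S_eq S, ite_S_eq S, ite_S_eq S]
        field_simp
    _ = (1 / 2 : ℂ) * ((χ (⟨((-m₀) % (S : ℤ)).toNat, toNat_emod_lt S hS (-m₀)⟩, ⟨((-m₁) % (S : ℤ)).toNat, toNat_emod_lt S hS (-m₁)⟩,
          ⟨((-m₂) % (S : ℤ)).toNat, toNat_emod_lt S hS (-m₂)⟩) : ℂ) +
        (χ (⟨(m₀ % (S : ℤ)).toNat, toNat_emod_lt S hS m₀⟩, ⟨(m₁ % (S : ℤ)).toNat, toNat_emod_lt S hS m₁⟩,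
          ⟨(m₂ % (S : ℤ)).toNat, toNat_emod_lt S hS m₂⟩) : ℂ)) := by
        rw [sum_indicator3 S hS (-m₀) (-m₁) (-m₂) (fun q => (χ q : ℂ)), sum_indicator3 S hS m₀ m₁ m₂ (fun q => (χ q : ℂ))]
    _ = _ := by
        rw [hsymm (⟨((-m₀) % (S : ℤ)).toNat, toNat_emod_lt S hS (-m₀)⟩, ⟨((-m₁) % (S : ℤ)).toNat, toNat_emod_lt S hS (-m₁)⟩,
            ⟨((-m₂) % (S : ℤ)).toNat, toNat_emod_lt S hS (-m₂)⟩)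
          (⟨(m₀ % (S : ℤ)).toNat, toNat_emod_lt S hS m₀⟩, ⟨(m₁ % (S : ℤ)).toNat, toNat_emod_lt S hS m₁⟩,
            ⟨(m₂ % (S : ℤ)).toNat, toNat_emod_lt S hS m₂⟩)
          (dvd_toNat_emod_neg_add S hS m₀) (dvd_toNat_emod_neg_add S hS m₁) (dvd_toNat_emod_neg_add S hS m₂)]
        ring

end Summit.QuantumFields.YangMills.Theorems.SqueezedSkewnessLowPassDFT

end
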